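import Literature.Probability.RandomPlanarGeometry.SAWBendingBlockRenewal
import Mathlib.Analysis.SpecificLimits.Normed
import Mathlib.Analysis.SpecialFunctions.ExpDeriv
import HarnessLib

/-!
# The 4-block upper curve for the bending free energy: `2t⁴B̂₄(e^{-s}) < 1 ⇒ κ(t) ≤ s`, and `κ(t) ≤ (15^{1/4} + o(1))·t`

Topic `Literature/Probability/RandomPlanarGeometry` (continues `SAWBendingBlockRenewal.lean`: the first-block renewal inequality
`Zbend_le_lowSum_add`, the block weights `A4w`, the low-part bound `lowSum_le`, `one_le_Zbend`; and `SAWBendingEnergy.lean`: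
`Zd.Zbend`, `Zd.bendFE`).

Lane «pcv-sawmu», route «STIFF» (a-idea-2 gen 8, ROUTES §37), item S3 at `m = 4` — the planner's Props `StiffUpper4_allt` and
`StiffUpper4_asymp` (`Sketch_v7_add1.lean` a62b149f2f7a9f12) VERBATIM over the tree objects, with proofs. Source for the model:
Madras–Slade 1993 §2.1; the explicit upper curve is the lane's (not in print).

## The argument

1. `hasSum_A4w`: `Σ_{n ∈ ℕ⁴} A₄(n) x^{|n|+4} = B̂₄(x) := 8(x/(1-x))⁴ - 2x⁴/((1-x)²(1-x²)²)` for `0 ≤ x < 1` — the free part is a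
   product of four shifted geometric series, the spiral correction a product of two "triangle" series
   `Σ_{b ≤ a} x^{a+1}x^{b+1} = x²/((1-x²)(1-x))` (reindex `(b, c) ↦ (b + c, b)`); hence every finite partial sum is `≤ B̂₄(x)`.
2. `gfPartial_le`: multiplying `Zbend_le_lowSum_add` by `x^N` and summing over `N ≤ M` gives, after exchanging the sums and
   re-indexing `N ↦ N - |n| - 4`, `S_M ≤ L + 2t⁴B̂₄(x)·S_M` with `S_M = Σ_{N ≤ M} Z_N(t)x^N` and `L = Σ_N max(1,t)³4⁴(N+1)⁴x^N < ∞`;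
   so `Z_N(t) x^N ≤ L/(1 - 2t⁴B̂₄(x))` for every `N` (`Zbend_mul_pow_le`).
3. `StiffUpper4_allt_holds`: with `x = e^{-s}`, every term `log(max(1,t)Z_{N+1}(t))/(N+1)` of the infimum `κ(t)` is at most
   `s + log(max(1,t)G)/(N+1)`, and the infimum is bounded below by `0` (`Z ≥ 1`), so `κ(t) ≤ s`.
4. `tendsto_pow_four_mul_B4hat`: `u⁴B̂₄(e^{-u}) → 8 - 2·(1/2)² = 15/2` (`u/(1-e^{-u}) → 1`, `u/(1-e^{-2u}) → 1/2`); hence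
   `StiffUpper4_asymp_holds`: for `c = 2(15/16)^{1/4} + δ` (`c⁴ > 15`), `2t⁴B̂₄(e^{-ct}) → 15/c⁴ < 1`, so `κ(t) ≤ ct` for all
   small `t > 0`.

All proofs standard-axiom, no `sorry`. (Lean note: the product lemmas `Summable.mul_of_nonneg` / `HasSum.mul` are elaborated
without an expected type — against a target they trigger `whnf` time-outs on the `ℝ` instance paths.)
-/

noncomputable section

open Finset Filter Topology
open scoped BigOperators
open Literature.Probability.LatticeModels

namespace Literature.Probability.RandomPlanarGeometry.SAW

/-! ### The closed form `B̂₄(x) = Σ_{ℓ ∈ ℕ_{≥1}^4} A₄(ℓ) x^{|ℓ|}` -/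

namespace Zd

/-- `B̂₄(x) = 8 (x/(1-x))⁴ − 2 x⁴/((1-x)²(1-x²)²)` — planner's `B4hat` (a-idea-2 `Sketch_v7_add1.lean`) VERBATIM.
[cite: MadrasSlade1993, §2.1] -/
def B4hat (x : ℝ) : ℝ := 8 * (x / (1 - x)) ^ 4 - 2 * x ^ 4 / ((1 - x) ^ 2 * (1 - x ^ 2) ^ 2)

end Zd

section GF

variable {x : ℝ}

/-- Shifted geometric series: `Σ_n x^{n+1} = x/(1-x)`. [folklore] -/
private theorem hasSum_pow_succ (hx0 : 0 ≤ x) (hx : x < 1) : HasSum (fun n : ℕ => x ^ (n + 1)) (x / (1 - x)) := by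
  have h := (hasSum_geometric_of_lt_one hx0 hx).mul_left x
  have e : (fun n : ℕ => x ^ (n + 1)) = fun i => x * x ^ i := by funext n; ring
  rw [e, div_eq_mul_inv]
  exact h

/-- The "triangle" series `Σ_{b ≤ a} x^{a+1} x^{b+1} = x²/((1-x²)(1-x))`. [folklore] -/
private theorem hasSum_triangle (hx0 : 0 ≤ x) (hx : x < 1) :
    HasSum (fun p : ℕ × ℕ => if p.2 ≤ p.1 then x ^ (p.1 + 1) * x ^ (p.2 + 1) else 0)
      (x ^ 2 / ((1 - x ^ 2) * (1 - x))) := by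
  set f : ℕ × ℕ → ℝ := fun p => if p.2 ≤ p.1 then x ^ (p.1 + 1) * x ^ (p.2 + 1) else 0 with hf
  set φ : ℕ × ℕ → ℕ × ℕ := fun q => (q.1 + q.2, q.1) with hφ
  have hφi : Function.Injective φ := by
    intro q q' h
    simp only [hφ, Prod.mk.injEq] at h
    ext <;> omega
  have hvan : ∀ p ∉ Set.range φ, f p = 0 := by
    intro p hp
    rw [hf]; dsimp only
    rw [if_neg]
    intro hle
    refine hp ⟨(p.2, p.1 - p.2), ?_⟩
    simp only [hφ]
    ext
    · show p.2 + (p.1 - p.2) = p.1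
      omega
    · rfl
  rw [← hφi.hasSum_iff hvan]
  have hx2 : x ^ 2 < 1 := by nlinarith
  have hx20 : 0 ≤ x ^ 2 := by positivity
  have hg1 : HasSum (fun b : ℕ => x ^ 2 * (x ^ 2) ^ b) (x ^ 2 * (1 - x ^ 2)⁻¹) :=
    (hasSum_geometric_of_lt_one hx20 hx2).mul_left _
  have hg2 : HasSum (fun c : ℕ => x ^ c) (1 - x)⁻¹ := hasSum_geometric_of_lt_one hx0 hx
  have hprod := hg1.summable.mul_of_nonneg hg2.summable (fun b => mul_nonneg hx20 (pow_nonneg hx20 b))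
      (fun c => pow_nonneg hx0 c)
  have h := hg1.mul hg2 hprod
  have e : x ^ 2 * (1 - x ^ 2)⁻¹ * (1 - x)⁻¹ = x ^ 2 / ((1 - x ^ 2) * (1 - x)) := by
    rw [div_eq_mul_inv, mul_inv]; ring
  rw [e] at h
  have e2 : f ∘ φ = fun q : ℕ × ℕ => x ^ 2 * (x ^ 2) ^ q.1 * x ^ q.2 := by
    funext q
    simp only [Function.comp_apply, hφ, hf, le_add_iff_nonneg_right, zero_le, if_true]
    ring
  rw [e2]
  exact h

/-- The free 2-run series `Σ_{a,b} x^{a+1} x^{b+1} = (x/(1-x))²`. [folklore] -/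
private theorem hasSum_pair (hx0 : 0 ≤ x) (hx : x < 1) :
    HasSum (fun p : ℕ × ℕ => x ^ (p.1 + 1) * x ^ (p.2 + 1)) ((x / (1 - x)) * (x / (1 - x))) := by
  have h1 : HasSum (fun n : ℕ => x ^ (n + 1)) (x / (1 - x)) := hasSum_pow_succ hx0 hx
  have hnn : ∀ n : ℕ, 0 ≤ x ^ (n + 1) := fun n => pow_nonneg hx0 (n + 1)
  -- (elaborated without expected type: the product lemmas do not unify well against a target)
  have hs := h1.summable.mul_of_nonneg h1.summable hnn hnn
  have h := h1.mul h1 hs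
  exact h

/-- The 4-tuple index `(Fin 4 → ℕ) ≃ (ℕ × ℕ) × (ℕ × ℕ)`, pairing `(n₀, n₂)` and `(n₁, n₃)`. [folklore] -/
private def quadEquiv : (Fin 4 → ℕ) ≃ (ℕ × ℕ) × (ℕ × ℕ) where
  toFun n := ((n 0, n 2), (n 1, n 3))
  invFun p := ![p.1.1, p.2.1, p.1.2, p.2.2]
  left_inv n := by funext i; fin_cases i <;> simp
  right_inv p := by obtain ⟨⟨a, b⟩, ⟨c, d⟩⟩ := p; simp

/-- **The block generating function**: `Σ_{n ∈ ℕ^4} A₄(n) x^{|n|+4} = B̂₄(x)` for `0 ≤ x < 1`. [cite: MadrasSlade1993, §2.1] -/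
theorem hasSum_A4w (hx0 : 0 ≤ x) (hx : x < 1) :
    HasSum (fun n : Fin 4 → ℕ => A4w n * x ^ (nsum n + 4)) (Zd.B4hat x) := by
  rw [← quadEquiv.symm.hasSum_iff]
  -- the summand in the paired coordinates
  have hx1 : (1 : ℝ) - x ≠ 0 := by linarith
  have hx2 : (1 : ℝ) - x ^ 2 ≠ 0 := by nlinarith
  set T : ℝ := x ^ 2 / ((1 - x ^ 2) * (1 - x)) with hT
  set y : ℝ := x / (1 - x) with hy
  have hP := hasSum_pair hx0 hx
  have hPnn : ∀ p : ℕ × ℕ, 0 ≤ x ^ (p.1 + 1) * x ^ (p.2 + 1) := fun p =>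
    mul_nonneg (pow_nonneg hx0 _) (pow_nonneg hx0 _)
  have hGs := hP.summable.mul_of_nonneg hP.summable hPnn hPnn
  have hG := hP.mul hP hGs
  have hT1 := hasSum_triangle hx0 hx
  -- the second triangle has the opposite orientation: swap coordinates
  have hT2 : HasSum (fun p : ℕ × ℕ => if p.1 ≤ p.2 then x ^ (p.1 + 1) * x ^ (p.2 + 1) else 0) T := by
    rw [← (Equiv.prodComm ℕ ℕ).hasSum_iff]
    have eT : ((fun p : ℕ × ℕ => if p.1 ≤ p.2 then x ^ (p.1 + 1) * x ^ (p.2 + 1) else 0) ∘ ⇑(Equiv.prodComm ℕ ℕ))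
        = fun p : ℕ × ℕ => if p.2 ≤ p.1 then x ^ (p.1 + 1) * x ^ (p.2 + 1) else 0 := by
      funext p
      simp only [Function.comp_apply, Equiv.prodComm_apply, Prod.fst_swap, Prod.snd_swap]
      split_ifs <;> ring
    rw [eT]
    exact hT1
  have hT1nn : ∀ p : ℕ × ℕ, 0 ≤ (if p.2 ≤ p.1 then x ^ (p.1 + 1) * x ^ (p.2 + 1) else 0) := fun p => by
    split_ifs
    · exact mul_nonneg (pow_nonneg hx0 _) (pow_nonneg hx0 _)
    · exact le_rfl
  have hT2nn : ∀ p : ℕ × ℕ, 0 ≤ (if p.1 ≤ p.2 then x ^ (p.1 + 1) * x ^ (p.2 + 1) else 0) := fun p => by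
    split_ifs
    · exact mul_nonneg (pow_nonneg hx0 _) (pow_nonneg hx0 _)
    · exact le_rfl
  have hHs := hT1.summable.mul_of_nonneg hT2.summable hT1nn hT2nn
  have hH := hT1.mul hT2 hHs
  have hkey := (hG.mul_left 8).sub (hH.mul_left 2)
  have e : 8 * (y * y * (y * y)) - 2 * (T * T) = Zd.B4hat x := by
    rw [Zd.B4hat, hy, hT]
    field_simp
  rw [e] at hkey
  have e2 : ((fun n : Fin 4 → ℕ => A4w n * x ^ (nsum n + 4)) ∘ ⇑quadEquiv.symm) = fun p : (ℕ × ℕ) × (ℕ × ℕ) =>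
      8 * (x ^ (p.1.1 + 1) * x ^ (p.1.2 + 1) * (x ^ (p.2.1 + 1) * x ^ (p.2.2 + 1))) -
        2 * ((if p.1.2 ≤ p.1.1 then x ^ (p.1.1 + 1) * x ^ (p.1.2 + 1) else 0) *
          (if p.2.1 ≤ p.2.2 then x ^ (p.2.1 + 1) * x ^ (p.2.2 + 1) else 0)) := by
    funext p
    obtain ⟨⟨a, b⟩, ⟨c, d⟩⟩ := p
    simp only [Function.comp_apply, quadEquiv, Equiv.coe_fn_symm_mk, A4w, nsum, Matrix.cons_val_zero,
      Matrix.cons_val_one, Matrix.cons_val]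
    by_cases h1 : b ≤ a <;> by_cases h2 : c ≤ d <;> simp [h1, h2] <;> ring
  rw [e2]
  exact hkey

/-- Every finite partial sum of the block generating function is at most `B̂₄(x)`. [cite: MadrasSlade1993, §2.1] -/
theorem sum_A4w_le_B4hat (hx0 : 0 ≤ x) (hx : x < 1) (S : Finset (Fin 4 → ℕ)) :
    ∑ n ∈ S, A4w n * x ^ (nsum n + 4) ≤ Zd.B4hat x :=
  sum_le_hasSum S (fun n _ => mul_nonneg (A4w_nonneg n) (by positivity)) (hasSum_A4w hx0 hx)

end GF

/-! ### Summing the renewal inequality: `Z_N(t) x^N ≤ G` whenever `2t⁴ B̂₄(x) < 1` -/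

section Bound

variable {t x : ℝ}

/-- Partial sums of the bending generating function `Σ_{N ≤ M} Z_N(t) x^N`. [cite: MadrasSlade1993, §2.1] -/
def gfPartial (t x : ℝ) (M : ℕ) : ℝ := ∑ N ∈ Finset.range (M + 1), Zd.Zbend N t * x ^ N

/-- `Z_N(t) ≥ 0`. [cite: MadrasSlade1993, §2.1] -/
theorem Zbend_nonneg (N : ℕ) (ht : 0 ≤ t) : 0 ≤ Zd.Zbend N t :=
  Finset.sum_nonneg fun _ _ => by positivity

/-- Partial sums are nonnegative and monotone. [cite: MadrasSlade1993, §2.1] -/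
theorem gfPartial_mono (ht : 0 ≤ t) (hx : 0 ≤ x) {M M' : ℕ} (h : M ≤ M') : gfPartial t x M ≤ gfPartial t x M' :=
  Finset.sum_le_sum_of_subset_of_nonneg (Finset.range_mono (by omega))
    fun N _ _ => mul_nonneg (Zbend_nonneg N ht) (pow_nonneg hx N)

/-- A convergent majorant for the low part: `Σ_N max(1,t)³ 4⁴ (N+1)⁴ x^N`. [cite: MadrasSlade1993, §2.1] -/
theorem summable_lowMajorant (hx0 : 0 ≤ x) (hx : x < 1) :
    Summable fun N : ℕ => max 1 t ^ 3 * (4 ^ 4 * ((N : ℝ) + 1) ^ 4) * x ^ N := by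
  have h1 : Summable fun n : ℕ => ((n : ℝ) ^ 4 : ℝ) * x ^ n :=
    summable_pow_mul_geometric_of_norm_lt_one 4 (by rwa [Real.norm_eq_abs, abs_of_nonneg hx0])
  have h2 : Summable fun n : ℕ => (((n + 1 : ℕ) : ℝ) ^ 4 : ℝ) * x ^ (n + 1) := (summable_nat_add_iff 1).2 h1
  rcases eq_or_lt_of_le hx0 with rfl | hxpos
  · refine summable_of_ne_finset_zero (s := {0}) fun N hN => ?_
    rw [Finset.mem_singleton] at hN
    simp [zero_pow hN]
  · have h3 : Summable fun n : ℕ => x⁻¹ * ((((n + 1 : ℕ) : ℝ) ^ 4 : ℝ) * x ^ (n + 1)) := h2.mul_left _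
    refine (h3.mul_left (max 1 t ^ 3 * 4 ^ 4)).congr fun N => ?_
    push_cast
    field_simp
    ring

/-- **Summation of the renewal inequality**: for `0 < x < 1` and `2t⁴B̂₄(x) < 1`, every partial sum satisfies
`S_M ≤ L + 2t⁴B̂₄(x) S_M` with `L` the low majorant, hence `S_M ≤ L/(1 - 2t⁴B̂₄(x))`. [cite: MadrasSlade1993, §2.1] -/
theorem gfPartial_le (ht : 0 ≤ t) (hx0 : 0 < x) (hx : x < 1) (hq : 2 * t ^ 4 * Zd.B4hat x < 1) (M : ℕ) :
    gfPartial t x M ≤ (∑' N : ℕ, max 1 t ^ 3 * (4 ^ 4 * ((N : ℝ) + 1) ^ 4) * x ^ N) / (1 - 2 * t ^ 4 * Zd.B4hat x) := by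
  classical
  set L := ∑' N : ℕ, max 1 t ^ 3 * (4 ^ 4 * ((N : ℝ) + 1) ^ 4) * x ^ N with hL
  set q := 2 * t ^ 4 * Zd.B4hat x with hqdef
  have hS0 : 0 ≤ gfPartial t x M :=
    Finset.sum_nonneg fun N _ => mul_nonneg (Zbend_nonneg N ht) (pow_nonneg hx0.le N)
  -- Step 1: termwise renewal inequality times x^N
  have hstep : ∀ N ∈ Finset.range (M + 1), Zd.Zbend N t * x ^ N ≤ lowSum N t * x ^ N +
      2 * t ^ 4 * ∑ n ∈ nbox N, A4w n * x ^ (nsum n + 4) * (Zd.Zbend (N - (nsum n + 4)) t * x ^ (N - (nsum n + 4))) := by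
    intro N _
    have h := mul_le_mul_of_nonneg_right (Zbend_le_lowSum_add ht N) (pow_nonneg hx0.le N)
    rw [add_mul, mul_assoc (2 * t ^ 4), Finset.sum_mul] at h
    refine h.trans (le_of_eq ?_)
    congr 2
    refine Finset.sum_congr rfl fun n hn => ?_
    rw [nbox, Finset.mem_filter] at hn
    have e : x ^ N = x ^ (nsum n + 4) * x ^ (N - (nsum n + 4)) := by
      rw [← pow_add]; congr 1; omega
    rw [e]; ring
  -- Step 2: sum over N ≤ M
  have hsum : gfPartial t x M ≤ ∑ N ∈ Finset.range (M + 1), lowSum N t * x ^ N +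
      2 * t ^ 4 * ∑ N ∈ Finset.range (M + 1), ∑ n ∈ nbox N,
        A4w n * x ^ (nsum n + 4) * (Zd.Zbend (N - (nsum n + 4)) t * x ^ (N - (nsum n + 4))) := by
    rw [gfPartial, Finset.mul_sum, ← Finset.sum_add_distrib]
    exact Finset.sum_le_sum hstep
  -- Step 3: the low part is at most L
  have hlow : ∑ N ∈ Finset.range (M + 1), lowSum N t * x ^ N ≤ L := by
    calc ∑ N ∈ Finset.range (M + 1), lowSum N t * x ^ N
        ≤ ∑ N ∈ Finset.range (M + 1), max 1 t ^ 3 * (4 ^ 4 * ((N : ℝ) + 1) ^ 4) * x ^ N :=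
          Finset.sum_le_sum fun N _ => mul_le_mul_of_nonneg_right (lowSum_le ht N) (pow_nonneg hx0.le N)
      _ ≤ L := (summable_lowMajorant hx0.le hx).sum_le_tsum _ (fun N _ => by positivity)
  -- Step 4: exchange the sums and bound the inner ones by `gfPartial t x M`
  set g : (Fin 4 → ℕ) → ℕ → ℝ := fun n N =>
    A4w n * x ^ (nsum n + 4) * (Zd.Zbend (N - (nsum n + 4)) t * x ^ (N - (nsum n + 4))) with hg
  have hcomm : ∑ N ∈ Finset.range (M + 1), ∑ n ∈ nbox N, g n N
      = ∑ n ∈ nbox M, ∑ N ∈ (Finset.range (M + 1)).filter (fun N => n ∈ nbox N), g n N := by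
    refine Finset.sum_comm' fun N n => ?_
    constructor
    · rintro ⟨hN, hn⟩
      refine ⟨Finset.mem_filter.2 ⟨hN, hn⟩, ?_⟩
      simp only [nbox, Finset.mem_filter, Fintype.mem_piFinset, Finset.mem_range] at hn hN ⊢
      refine ⟨fun i => ?_, by omega⟩
      have := hn.1 i; omega
    · rintro ⟨hN, -⟩
      rw [Finset.mem_filter] at hN
      exact ⟨hN.1, hN.2⟩
  have hinner : ∀ n ∈ nbox M, ∑ N ∈ (Finset.range (M + 1)).filter (fun N => n ∈ nbox N),
      Zd.Zbend (N - (nsum n + 4)) t * x ^ (N - (nsum n + 4)) ≤ gfPartial t x M := by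
    intro n _
    set c := nsum n + 4 with hc
    set F := (Finset.range (M + 1)).filter (fun N => n ∈ nbox N) with hF
    have hinj : Set.InjOn (fun N => N - c) F := by
      intro N hN N' hN' h
      simp only [hF, Finset.coe_filter, Set.mem_setOf_eq, nbox, Finset.mem_filter] at hN hN'
      have h1 := hN.2.2; have h2 := hN'.2.2
      simp only at h
      omega
    calc ∑ N ∈ F, Zd.Zbend (N - c) t * x ^ (N - c)
        = ∑ K ∈ F.image (fun N => N - c), Zd.Zbend K t * x ^ K := by rw [Finset.sum_image hinj]
      _ ≤ gfPartial t x M := by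
          refine Finset.sum_le_sum_of_subset_of_nonneg (fun K hK => ?_)
            fun K _ _ => mul_nonneg (Zbend_nonneg K ht) (pow_nonneg hx0.le K)
          rw [Finset.mem_image] at hK
          obtain ⟨N, hN, rfl⟩ := hK
          rw [hF, Finset.mem_filter, Finset.mem_range] at hN
          exact Finset.mem_range.2 (by omega)
  have hexch : ∑ N ∈ Finset.range (M + 1), ∑ n ∈ nbox N, g n N ≤ Zd.B4hat x * gfPartial t x M := by
    rw [hcomm]
    calc ∑ n ∈ nbox M, ∑ N ∈ (Finset.range (M + 1)).filter (fun N => n ∈ nbox N), g n N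
        = ∑ n ∈ nbox M, A4w n * x ^ (nsum n + 4) * ∑ N ∈ (Finset.range (M + 1)).filter (fun N => n ∈ nbox N),
            Zd.Zbend (N - (nsum n + 4)) t * x ^ (N - (nsum n + 4)) := by
          refine Finset.sum_congr rfl fun n _ => by rw [hg, Finset.mul_sum]
      _ ≤ ∑ n ∈ nbox M, A4w n * x ^ (nsum n + 4) * gfPartial t x M :=
          Finset.sum_le_sum fun n hn => mul_le_mul_of_nonneg_left (hinner n hn)
            (mul_nonneg (A4w_nonneg n) (by positivity))
      _ = (∑ n ∈ nbox M, A4w n * x ^ (nsum n + 4)) * gfPartial t x M := by rw [Finset.sum_mul]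
      _ ≤ Zd.B4hat x * gfPartial t x M := mul_le_mul_of_nonneg_right (sum_A4w_le_B4hat hx0.le hx _) hS0
  -- Step 5: conclude
  have hB0 : 0 ≤ Zd.B4hat x := le_trans (Finset.sum_nonneg fun n _ => mul_nonneg (A4w_nonneg n) (by positivity))
    (sum_A4w_le_B4hat hx0.le hx ∅)
  have hq1 : 0 < 1 - q := by linarith
  have hmain : gfPartial t x M ≤ L + q * gfPartial t x M := by
    have hsum' : gfPartial t x M ≤ ∑ N ∈ Finset.range (M + 1), lowSum N t * x ^ N +
        2 * t ^ 4 * ∑ N ∈ Finset.range (M + 1), ∑ n ∈ nbox N, g n N := by simpa only [hg] using hsum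
    calc gfPartial t x M ≤ _ := hsum'
      _ ≤ L + 2 * t ^ 4 * (Zd.B4hat x * gfPartial t x M) :=
          add_le_add hlow (mul_le_mul_of_nonneg_left hexch (by positivity))
      _ = L + q * gfPartial t x M := by rw [hqdef]; ring
  rw [le_div_iff₀ hq1]
  nlinarith

/-- **The bending generating function converges**: `Z_N(t) x^N ≤ G(t, x)` for every `N`, where
`G = L/(1 - 2t⁴B̂₄(x))` is finite, whenever `0 < x < 1` and `2t⁴ B̂₄(x) < 1`. [cite: MadrasSlade1993, §2.1] -/
theorem Zbend_mul_pow_le (ht : 0 ≤ t) (hx0 : 0 < x) (hx : x < 1) (hq : 2 * t ^ 4 * Zd.B4hat x < 1) (N : ℕ) :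
    Zd.Zbend N t * x ^ N ≤ (∑' N : ℕ, max 1 t ^ 3 * (4 ^ 4 * ((N : ℝ) + 1) ^ 4) * x ^ N) / (1 - 2 * t ^ 4 * Zd.B4hat x) := by
  refine le_trans ?_ (gfPartial_le ht hx0 hx hq N)
  rw [gfPartial]
  exact Finset.single_le_sum (f := fun K => Zd.Zbend K t * x ^ K)
    (fun K _ => mul_nonneg (Zbend_nonneg K ht) (pow_nonneg hx0.le K)) (Finset.mem_range.2 (Nat.lt_succ_self N))

end Bound

/-! ### The targets: `StiffUpper4_allt` (verbatim Prop) and its proof -/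

namespace Zd

/-- Every SAW splits into (first direction) × blocks of 4 consecutive segments (each block self-avoiding, internal turn
weight `t³`) × free junction turns (weight `2t`) × a tail of ≤ 3 segments; hence the generating function
`Σ_N Z_N(t) x^N` converges whenever `2 t⁴ B̂₄(x) < 1`, `0 < x < 1`, i.e. `κ(t) ≤ -log x`. Typed with `x = e^{-s}`.
Planner's Prop `StiffUpper4_allt` VERBATIM (a-idea-2 `Sketch_v7_add1.lean`). [cite: MadrasSlade1993, §2.1] -/
def StiffUpper4_allt : Prop :=
  ∀ t s : ℝ, 0 < t → 0 < s → 2 * t ^ 4 * B4hat (Real.exp (-s)) < 1 → bendFE t ≤ s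

/-- **`StiffUpper4_allt` holds**: `2t⁴ B̂₄(e^{-s}) < 1 ⇒ κ(t) ≤ s`. [cite: MadrasSlade1993, §2.1] -/
theorem StiffUpper4_allt_holds : StiffUpper4_allt := by
  intro t s ht hs hq
  set x := Real.exp (-s) with hxdef
  have hx0 : 0 < x := Real.exp_pos _
  have hx1 : x < 1 := Real.exp_lt_one_iff.2 (by linarith)
  set G := (∑' N : ℕ, max 1 t ^ 3 * (4 ^ 4 * ((N : ℝ) + 1) ^ 4) * x ^ N) / (1 - 2 * t ^ 4 * B4hat x) with hG
  have hZle : ∀ N, Zbend N t * x ^ N ≤ G := fun N => Zbend_mul_pow_le ht.le hx0 hx1 hq N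
  have hm : 1 ≤ max 1 t := le_max_left 1 t
  -- `Z_{N+1}(t) ≥ 1` (the straight walk), hence `G > 0`
  have hZ1 : ∀ N, 1 ≤ Zbend (N + 1) t := fun N => one_le_Zbend (N + 1) ht.le
  have hGpos : 0 < G := by
    have h := hZle 1
    have : 0 < Zbend 1 t * x ^ 1 := mul_pos (by linarith [hZ1 0]) (pow_pos hx0 1)
    linarith
  -- each term of the infimum is at most `s + log(max(1,t) G)/(N+1)`
  set C := Real.log (max 1 t * G) with hC
  have hterm : ∀ N : ℕ, Real.log (max 1 t * Zbend (N + 1) t) / ((N : ℝ) + 1) ≤ s + C / ((N : ℝ) + 1) := by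
    intro N
    have hN : (0 : ℝ) < (N : ℝ) + 1 := by positivity
    have hxpow : x ^ (N + 1) = Real.exp (-(s * ((N : ℝ) + 1))) := by
      rw [hxdef, ← Real.exp_nat_mul]; congr 1; push_cast; ring
    have h1 : Zbend (N + 1) t ≤ G * Real.exp (s * ((N : ℝ) + 1)) := by
      have h := hZle (N + 1)
      rw [hxpow] at h
      have hE : 0 < Real.exp (-(s * ((N : ℝ) + 1))) := Real.exp_pos _
      calc Zbend (N + 1) t = Zbend (N + 1) t * Real.exp (-(s * ((N : ℝ) + 1))) * Real.exp (s * ((N : ℝ) + 1)) := by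
            rw [mul_assoc, ← Real.exp_add]; simp
        _ ≤ G * Real.exp (s * ((N : ℝ) + 1)) := mul_le_mul_of_nonneg_right h (Real.exp_pos _).le
    have h2 : max 1 t * Zbend (N + 1) t ≤ (max 1 t * G) * Real.exp (s * ((N : ℝ) + 1)) := by
      rw [mul_assoc]; exact mul_le_mul_of_nonneg_left h1 (by positivity)
    have hpos : 0 < max 1 t * Zbend (N + 1) t := mul_pos (by positivity) (by linarith [hZ1 N])
    have h3 : Real.log (max 1 t * Zbend (N + 1) t) ≤ C + s * ((N : ℝ) + 1) := by
      have := Real.log_le_log hpos h2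
      rwa [Real.log_mul (by positivity) (Real.exp_pos _).ne', Real.log_exp] at this
    rw [div_le_iff₀ hN]
    have e : (s + C / ((N : ℝ) + 1)) * ((N : ℝ) + 1) = C + s * ((N : ℝ) + 1) := by field_simp; ring
    rw [e]; exact h3
  -- the infimum is bounded below by `0`
  have hbdd : BddBelow (Set.range fun N : ℕ => Real.log (max 1 t * Zbend (N + 1) t) / ((N : ℝ) + 1)) := by
    refine ⟨0, ?_⟩
    rintro _ ⟨N, rfl⟩
    refine div_nonneg (Real.log_nonneg ?_) (by positivity)
    nlinarith [hZ1 N]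
  -- conclude: `κ(t) ≤ s + ε` for every `ε > 0`
  refine le_of_forall_pos_lt_add fun ε hε => ?_
  obtain ⟨N, hN⟩ := exists_nat_gt (C / ε)
  have hNpos : (0 : ℝ) < (N : ℝ) + 1 := by positivity
  have hCN : C / ((N : ℝ) + 1) < ε := by
    rw [div_lt_iff₀ hNpos]
    rw [div_lt_iff₀ hε] at hN
    nlinarith
  calc bendFE t ≤ Real.log (max 1 t * Zbend (N + 1) t) / ((N : ℝ) + 1) := ciInf_le hbdd N
    _ ≤ s + C / ((N : ℝ) + 1) := hterm N
    _ < s + ε := by linarith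

/-- Its small-`t` consequence (= frozen `StiffLimit_upper 4` with the constant made explicit: `(1-x)⁴ B̂₄(x) → 15/2 = 8σ₄`).
Planner's Prop `StiffUpper4_asymp` VERBATIM (a-idea-2 `Sketch_v7_add1.lean`). [cite: MadrasSlade1993, §2.1] -/
def StiffUpper4_asymp : Prop :=
  ∀ δ > 0, ∀ᶠ t in 𝓝[>] (0 : ℝ), bendFE t ≤ (2 * (15 / 16 : ℝ) ^ (1 / 4 : ℝ) + δ) * t

/-- `(1 - e^{-au})/u → a` as `u → 0` (`u ≠ 0`): the derivative of `u ↦ 1 - e^{-au}` at `0`. [folklore] -/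
private theorem tendsto_one_sub_exp_div (a : ℝ) :
    Tendsto (fun u : ℝ => (1 - Real.exp (-a * u)) / u) (𝓝[≠] 0) (𝓝 a) := by
  have h1 : HasDerivAt (fun u : ℝ => -a * u) (-a) 0 := by
    simpa using (hasDerivAt_id (0 : ℝ)).const_mul (-a)
  have h2 : HasDerivAt (fun u : ℝ => Real.exp (-a * u)) (Real.exp (-a * 0) * (-a)) 0 :=
    (Real.hasDerivAt_exp _).comp 0 h1
  have h3 : HasDerivAt (fun u : ℝ => 1 - Real.exp (-a * u)) (0 - Real.exp (-a * 0) * (-a)) 0 :=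
    (hasDerivAt_const 0 1).sub h2
  have e : (0 : ℝ) - Real.exp (-a * 0) * (-a) = a := by simp
  rw [e, hasDerivAt_iff_tendsto_slope] at h3
  refine h3.congr' (Filter.Eventually.of_forall fun u => ?_)
  simp [slope_def_field]

/-- `u / (1 - e^{-au}) → a⁻¹` as `u → 0⁺`, for `a > 0`. [folklore] -/
private theorem tendsto_div_one_sub_exp {a : ℝ} (ha : 0 < a) :
    Tendsto (fun u : ℝ => u / (1 - Real.exp (-a * u))) (𝓝[>] 0) (𝓝 a⁻¹) := by
  have h := ((tendsto_one_sub_exp_div a).mono_left (nhdsWithin_mono _ fun u (hu : 0 < u) => ne_of_gt hu)).inv₀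
    ha.ne'
  refine h.congr' (Filter.Eventually.of_forall fun u => ?_)
  simp [inv_div]

/-- **The block curve near the origin**: `u⁴ · B̂₄(e^{-u}) → 15/2` as `u → 0⁺` (`8 - 2·(1/2)² = 15/2 = 8σ₄`).
[cite: MadrasSlade1993, §2.1] -/
theorem tendsto_pow_four_mul_B4hat :
    Tendsto (fun u : ℝ => u ^ 4 * B4hat (Real.exp (-u))) (𝓝[>] 0) (𝓝 (15 / 2)) := by
  -- the three elementary limits
  have hA : Tendsto (fun u : ℝ => u / (1 - Real.exp (-u))) (𝓝[>] 0) (𝓝 1) := by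
    simpa using tendsto_div_one_sub_exp one_pos
  have hB : Tendsto (fun u : ℝ => u / (1 - Real.exp (-2 * u))) (𝓝[>] 0) (𝓝 (2 : ℝ)⁻¹) :=
    tendsto_div_one_sub_exp two_pos
  have hX : Tendsto (fun u : ℝ => Real.exp (-u)) (𝓝[>] 0) (𝓝 1) := by
    have : Tendsto (fun u : ℝ => Real.exp (-u)) (𝓝 0) (𝓝 (Real.exp (-0))) :=
      (Real.continuous_exp.comp continuous_neg).tendsto 0
    simpa using this.mono_left nhdsWithin_le_nhds
  -- combine
  have hF : Tendsto (fun u : ℝ => 8 * (Real.exp (-u) * (u / (1 - Real.exp (-u)))) ^ 4 -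
      2 * Real.exp (-u) ^ 4 * (u / (1 - Real.exp (-u))) ^ 2 * (u / (1 - Real.exp (-2 * u))) ^ 2)
      (𝓝[>] 0) (𝓝 (8 * (1 * 1) ^ 4 - 2 * 1 ^ 4 * 1 ^ 2 * ((2 : ℝ)⁻¹) ^ 2)) :=
    ((((hX.mul hA).pow 4).const_mul 8).sub ((((hX.pow 4).const_mul 2).mul (hA.pow 2)).mul (hB.pow 2)))
  have e : (8 * (1 * 1) ^ 4 - 2 * 1 ^ 4 * 1 ^ 2 * ((2 : ℝ)⁻¹) ^ 2 : ℝ) = 15 / 2 := by norm_num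
  rw [e] at hF
  refine hF.congr' ?_
  filter_upwards [self_mem_nhdsWithin] with u hu
  have hu0 : (0 : ℝ) < u := hu
  have hx1 : Real.exp (-u) < 1 := Real.exp_lt_one_iff.2 (by linarith)
  have h1 : (1 : ℝ) - Real.exp (-u) ≠ 0 := by linarith
  have h2 : (1 : ℝ) - Real.exp (-2 * u) ≠ 0 := by
    have : Real.exp (-2 * u) < 1 := Real.exp_lt_one_iff.2 (by linarith); linarith
  have e2 : Real.exp (-2 * u) = Real.exp (-u) ^ 2 := by rw [← Real.exp_nat_mul]; ring_nf
  have h2' : (1 : ℝ) - Real.exp (-u) ^ 2 ≠ 0 := by rwa [e2] at h2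
  rw [B4hat, e2]
  field_simp

/-- **`StiffUpper4_asymp` holds**: for every `δ > 0`, `κ(t) ≤ (2(15/16)^{1/4} + δ) t` for all small `t > 0`
(with `c := 2(15/16)^{1/4} + δ`, `2t⁴B̂₄(e^{-ct}) = (2/c⁴)·(ct)⁴B̂₄(e^{-ct}) → 15/c⁴ < 1`). [cite: MadrasSlade1993, §2.1] -/
theorem StiffUpper4_asymp_holds : StiffUpper4_asymp := by
  intro δ hδ
  set c₀ : ℝ := 2 * (15 / 16 : ℝ) ^ (1 / 4 : ℝ) with hc₀
  set c : ℝ := c₀ + δ with hc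
  have hc₀pos : 0 < c₀ := by rw [hc₀]; positivity
  have hcpos : 0 < c := by linarith
  have hc₀4 : c₀ ^ 4 = 15 := by
    rw [hc₀, mul_pow, ← Real.rpow_natCast ((15 / 16 : ℝ) ^ (1 / 4 : ℝ)) 4, ← Real.rpow_mul (by norm_num)]
    norm_num
  have hc4 : 15 < c ^ 4 := by
    rw [← hc₀4]
    exact pow_lt_pow_left₀ (by linarith) hc₀pos.le (by norm_num)
  -- `t ↦ c t` maps `𝓝[>] 0` into `𝓝[>] 0`
  have hct : Tendsto (fun t : ℝ => c * t) (𝓝[>] 0) (𝓝[>] 0) := by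
    refine tendsto_nhdsWithin_iff.2 ⟨?_, ?_⟩
    · have : Tendsto (fun t : ℝ => c * t) (𝓝 0) (𝓝 (c * 0)) := (continuous_const.mul continuous_id).tendsto 0
      rw [mul_zero] at this
      exact this.mono_left nhdsWithin_le_nhds
    · filter_upwards [self_mem_nhdsWithin] with t ht
      exact mul_pos hcpos ht
  have hlim : Tendsto (fun t : ℝ => 2 * t ^ 4 * B4hat (Real.exp (-(c * t)))) (𝓝[>] 0) (𝓝 (2 / c ^ 4 * (15 / 2))) := by
    have h := (tendsto_pow_four_mul_B4hat.comp hct).const_mul (2 / c ^ 4)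
    refine h.congr' (Filter.Eventually.of_forall fun t => ?_)
    simp only [Function.comp_apply]
    field_simp
  have hlt : 2 / c ^ 4 * (15 / 2) < 1 := by
    rw [div_mul_eq_mul_div, div_lt_one (by positivity)]; linarith
  have hev := hlim.eventually_lt_const hlt
  filter_upwards [hev, self_mem_nhdsWithin] with t hq ht
  have ht0 : (0 : ℝ) < t := ht
  have h := StiffUpper4_allt_holds t (c * t) ht0 (mul_pos hcpos ht0) hq
  simpa [hc, hc₀] using h

end Zd

end Literature.Probability.RandomPlanarGeometry.SAW
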